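import Mathlib
import Summits.CriticalPhenomena.SAWScalingLimit.Theorems.SAWDefectDecoherenceDefectDecoherenceTmStarSums
import HarnessLib

/-!
# Exit strata, the crude constant, restriction of star sums
(helper `tm_crude_constant_le` for the stub `stub_telescopingRecursion` of the line
`tip-martingale-depth-induction`, crux `DefectDecoherence`, stmt-CriticalPhenomena-8549)

* The exit predicates on vertex lists: `Ex v L` (visits distance `> L`), `preE` (the vertices
  before the first exit from `B(v,L)`), `EE v L ρ` (comes within `ρ` before the first exit), their
  behaviour under gluing a first-entrance prefix (`stratum_append_iff`, `Ex_EE_append`,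
  `Ex_of_append`) and the telescoping of stratum indicators (`ite_telescope`).
* The termwise bound `‖TC‖ ≤ TR/(2√3)` (`norm_TC_le`), monotonicity of `TR` in the predicate and
  in the domain, and the CRUDE CONSTANT: `CrudeBound B₀` forces `B₀ ≥ 1/(2√3)` (`crude_constant_le`,
  registered as `tm_crude_constant_le`; witness: the one-vertex domain `{t₀}`).
* Restriction of `TC` to the walks staying in a subdomain with the same star (`TC_stay`).

Sources: H. Duminil-Copin, S. Smirnov, *The connective constant of the honeycomb lattice equals
`√(2+√2)`*, Ann. of Math. 175 (2012) (arXiv:1007.0575), §1–§2 (walks between mid-edges, windings,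
Definition 1); the line card `Lines/tip-martingale-depth-induction.md` of the crux.
Deliberately NOT here: the strata bound itself (file `…TmStrata`).
-/

noncomputable section

open scoped BigOperators ComplexConjugate Classical
open Literature.Probability.LatticeModels Literature.Probability.RandomPlanarGeometry.SAW

namespace Summit.CriticalPhenomena.SAWScalingLimit.Theorems.DefectDecoherence.TipMartingale

section ExitPredicates

variable {v : HexVertex} {L ρ : ℝ}

/-- The vertices of a walk strictly before its first exit from `B(v,L)`. [folklore] -/
def preE (v : HexVertex) (L : ℝ) (l : List HexVertex) : List HexVertex :=
  l.takeWhile fun q => decide (dist (hexCenter q) (hexCenter v) ≤ L)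

/-- The vertex lists visiting a vertex at distance `> L` from `c_v` (EXITING `B(v,L)`).
[folklore] -/
def Ex (v : HexVertex) (L : ℝ) : Set (List HexVertex) :=
  {l | ∃ q ∈ l, L < dist (hexCenter q) (hexCenter v)}

/-- The vertex lists coming within distance `ρ` of `c_v` before their first exit from `B(v,L)`.
[folklore] -/
def EE (v : HexVertex) (L ρ : ℝ) : Set (List HexVertex) :=
  {l | ∃ q ∈ preE v L l, dist (hexCenter q) (hexCenter v) ≤ ρ}

/-- Unfolding `Ex`. [folklore] -/
theorem mem_Ex {l : List HexVertex} : l ∈ Ex v L ↔ ∃ q ∈ l, L < dist (hexCenter q) (hexCenter v) :=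
  Iff.rfl

/-- Unfolding `EE`. [folklore] -/
theorem mem_EE {l : List HexVertex} :
    l ∈ EE v L ρ ↔ ∃ q ∈ preE v L l, dist (hexCenter q) (hexCenter v) ≤ ρ := Iff.rfl

/-- `takeWhile` of a concatenation whose first part already fails the test. [folklore] -/
theorem takeWhile_append_of_exists_not {α : Type*} {p : α → Bool} :
    ∀ {l₁ : List α} (l₂ : List α), (∃ a ∈ l₁, ¬ p a) → (l₁ ++ l₂).takeWhile p = l₁.takeWhile p
  | [], _, h => by simp at h
  | x :: xs, l₂, h => by
    rw [List.cons_append, List.takeWhile_cons, List.takeWhile_cons]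
    by_cases hx : p x
    · simp only [hx, ↓reduceIte, List.cons.injEq, true_and]
      refine takeWhile_append_of_exists_not l₂ ?_
      obtain ⟨a, ha, hpa⟩ := h
      rcases List.mem_cons.1 ha with rfl | ha
      · exact absurd hx hpa
      · exact ⟨a, ha, hpa⟩
    · simp [hx]

/-- After an exit, the pre-exit part is frozen. [folklore] -/
theorem preE_append_of_Ex {l₁ : List HexVertex} (h : l₁ ∈ Ex v L) (l₂ : List HexVertex) :
    preE v L (l₁ ++ l₂) = preE v L l₁ := by
  obtain ⟨q, hq, hqL⟩ := h
  exact takeWhile_append_of_exists_not l₂ ⟨q, hq, by simpa using hqL⟩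

/-- Without exit, the pre-exit part continues into the second list. [folklore] -/
theorem preE_append_of_not_Ex {l₁ : List HexVertex} (h : l₁ ∉ Ex v L) (l₂ : List HexVertex) :
    preE v L (l₁ ++ l₂) = l₁ ++ preE v L l₂ := by
  simp only [mem_Ex, not_exists, not_and, not_lt] at h
  exact List.takeWhile_append_of_pos fun a ha => by simpa using h a ha

/-- A first vertex inside `B(v,L)` is pre-exit. [folklore] -/
theorem mem_preE_cons {z : HexVertex} (hz : dist (hexCenter z) (hexCenter v) ≤ L)
    (l : List HexVertex) : z ∈ preE v L (z :: l) := by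
  rw [preE, List.takeWhile_cons_of_pos (by simpa using hz)]
  exact List.mem_cons_self

/-- Pre-exit vertices are vertices of the walk. [folklore] -/
theorem preE_subset (l : List HexVertex) : preE v L l ⊆ l := (List.takeWhile_sublist _).subset

/-- Exiting is inherited by extensions. [folklore] -/
theorem Ex_append {l₁ l₂ : List HexVertex} : l₁ ++ l₂ ∈ Ex v L ↔ l₁ ∈ Ex v L ∨ l₂ ∈ Ex v L := by
  simp only [mem_Ex, List.mem_append, or_and_right, exists_or]

/-- `EE` is monotone in the radius. [folklore] -/
theorem EE_mono {ρ ρ' : ℝ} (h : ρ ≤ ρ') {l : List HexVertex} (hl : l ∈ EE v L ρ) :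
    l ∈ EE v L ρ' := by
  obtain ⟨q, hq, hqρ⟩ := hl; exact ⟨q, hq, hqρ.trans h⟩

variable {D : Finset HexVertex} {a : Sym2 HexVertex} {y z : HexVertex} {ρ' : ℝ}

/-- **The stratum predicate is decided by the first-entrance prefix** into `B(v,ρ')`
(`ρ' ≤ L`): for a prefix `π` and a continuation starting inside `B(v,ρ')`,
`Ex ∧ EE ρ ∧ ¬ EE ρ'` of the glued list is `Ex ∧ EE ρ ∧ ¬ EE ρ'` of the prefix. [folklore] -/
theorem stratum_append_iff (hρ'L : ρ' ≤ L) {l₁ l₂ : List HexVertex} (hz : z ∈ l₂.head?)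
    (hzρ : dist (hexCenter z) (hexCenter v) ≤ ρ') :
    (l₁ ++ l₂ ∈ Ex v L ∧ l₁ ++ l₂ ∈ EE v L ρ ∧ l₁ ++ l₂ ∉ EE v L ρ') ↔
      (l₁ ∈ Ex v L ∧ l₁ ∈ EE v L ρ ∧ l₁ ∉ EE v L ρ') := by
  by_cases hx : l₁ ∈ Ex v L
  · simp only [mem_EE, preE_append_of_Ex hx, Ex_append, hx, true_or, true_and]
  · have h2 : l₁ ++ l₂ ∈ EE v L ρ' := by
      refine ⟨z, ?_, hzρ⟩
      rw [preE_append_of_not_Ex hx, List.eq_cons_of_mem_head? hz]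
      exact List.mem_append_right _ (mem_preE_cons (hzρ.trans hρ'L) _)
    simp [hx, h2]

/-- Prefix information survives gluing. [folklore] -/
theorem Ex_EE_append {l₁ : List HexVertex} (h : l₁ ∈ Ex v L ∧ l₁ ∈ EE v L ρ)
    (l₂ : List HexVertex) : l₁ ++ l₂ ∈ Ex v L ∧ l₁ ++ l₂ ∈ EE v L ρ := by
  refine ⟨Ex_append.2 (Or.inl h.1), ?_⟩
  rw [mem_EE, preE_append_of_Ex h.1]; exact h.2

/-- If the prefix stays at distance `> ρ`, an exiting glued walk that comes within `ρ` before its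
first exit must exit in the continuation. [folklore] -/
theorem Ex_of_append {l₁ l₂ : List HexVertex}
    (hout : ∀ q ∈ l₁, ρ < dist (hexCenter q) (hexCenter v))
    (h : l₁ ++ l₂ ∈ Ex v L ∧ l₁ ++ l₂ ∈ EE v L ρ) : l₂ ∈ Ex v L := by
  by_cases hx : l₁ ∈ Ex v L
  · obtain ⟨q, hq, hqρ⟩ := h.2
    rw [preE_append_of_Ex hx] at hq
    exact absurd (hout q (preE_subset _ hq)) (not_lt.2 hqρ)
  · exact (Ex_append.1 h.1).resolve_left hx

/-- One step of the telescoping of indicators. [folklore] -/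
theorem ite_telescope_step {M : Type*} [AddCommMonoid M] (P : ℕ → Prop)
    (hP : ∀ j, P (j + 1) → P j) (x : M) (N : ℕ) :
    ((if P N ∧ ¬ P (N + 1) then x else 0) + if P (N + 1) then x else 0) =
      if P N then x else 0 := by
  by_cases h1 : P (N + 1)
  · simp [h1, hP N h1]
  · simp [h1]

/-- **Telescoping of indicators** along a decreasing chain of events. [folklore] -/
theorem ite_telescope {M : Type*} [AddCommMonoid M] (P : ℕ → Prop) (hP : ∀ j, P (j + 1) → P j)
    (h0 : P 0) (x : M) : ∀ N : ℕ,
    x = (∑ j ∈ Finset.range N, if P j ∧ ¬ P (j + 1) then x else 0) + if P N then x else 0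
  | 0 => by simp [h0]
  | N + 1 => by
    rw [Finset.sum_range_succ, add_assoc, ite_telescope_step P hP x N]
    exact ite_telescope P hP h0 x N

end ExitPredicates

/-! ### Norm bounds and the crude constant -/

section Crude

variable {D : Finset HexVertex} {a : Sym2 HexVertex} {v : HexVertex}

/-- `‖mid{v,t} - c_v‖ = 1/(2√3)` for `t ∼ v`. [folklore] -/
theorem norm_mid_sub {t : HexVertex} (ht : hexGraph.Adj v t) :
    ‖hexMidpoint s(v, t) - hexCenter v‖ = 1 / 2 * (Real.sqrt 3)⁻¹ := by
  rw [hexMidpoint_mk, show (hexCenter v + hexCenter t) / 2 - hexCenter v =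
    (1 / 2 : ℂ) * (hexCenter t - hexCenter v) by ring, norm_mul, ← Complex.dist_eq,
    dist_hexCenter_of_adj ht.symm]
  norm_num

/-- **The termwise (triangle-inequality) bound** `‖TC‖ ≤ TR / (2√3)`. [folklore] -/
theorem norm_TC_le (D : Finset HexVertex) (a : Sym2 HexVertex) (v : HexVertex)
    (E : List HexVertex → Prop) : ‖TC D a v E‖ ≤ 1 / 2 * (Real.sqrt 3)⁻¹ * TR D a v E := by
  rw [TC, TR, Finset.mul_sum]
  refine (norm_sum_le _ _).trans (Finset.sum_le_sum fun t ht => ?_)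
  rw [norm_mul, Complex.norm_conj, norm_mid_sub (Finset.mem_filter.1 ht).2]
  refine mul_le_mul_of_nonneg_left ((norm_sum_le _ _).trans (Finset.sum_le_sum fun ω _ => ?_))
    (by positivity)
  split_ifs
  · exact (ω.norm_weight xc_pos.le _).le
  · simp

/-- `TR` is nonnegative. [folklore] -/
theorem TR_nonneg (D : Finset HexVertex) (a : Sym2 HexVertex) (v : HexVertex)
    (E : List HexVertex → Prop) : 0 ≤ TR D a v E :=
  Finset.sum_nonneg fun _ _ => Finset.sum_nonneg fun _ _ => by
    split_ifs
    · exact pow_nonneg xc_pos.le _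
    · exact le_rfl

/-- `TR` is monotone in the restricting predicate. [folklore] -/
theorem TR_mono {E E' : List HexVertex → Prop} (h : ∀ l, E l → E' l) (D : Finset HexVertex)
    (a : Sym2 HexVertex) (v : HexVertex) : TR D a v E ≤ TR D a v E' :=
  Finset.sum_le_sum fun _ _ => Finset.sum_le_sum fun ω _ => by
    by_cases hE : E ω.verts
    · rw [if_pos hE, if_pos (h _ hE)]
    · rw [if_neg hE]; split_ifs
      · exact pow_nonneg xc_pos.le _
      · exact le_rfl

/-- A walk of a subdomain is a walk of the domain. [folklore] -/
def inclW {D D' : Finset HexVertex} (h : D ⊆ D') {b : Sym2 HexVertex} (ω : HexMidEdgeSAW D a b) :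
    HexMidEdgeSAW D' a b where
  verts := ω.verts
  subset x hx := h (ω.subset x hx)
  nodup := ω.nodup
  isChain := ω.isChain
  head_mem := ω.head_mem
  getLast_mem := ω.getLast_mem
  eq_of_nil := ω.eq_of_nil
  edges_nodup := ω.edges_nodup
  fst_mem := by
    obtain ⟨he, y, hy, hyD⟩ := ω.fst_mem
    exact ⟨he, y, hy, h hyD⟩

/-- `TR` of a subdomain is at most `TR` of the domain (walks inject, stars compare). [folklore] -/
theorem TR_le_of_subset {D D' : Finset HexVertex} (hDD' : D ⊆ D') (a : Sym2 HexVertex)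
    (v : HexVertex) (E : List HexVertex → Prop) : TR D a v E ≤ TR D' a v E := by
  have hnn : ∀ (b : Sym2 HexVertex) (ω : HexMidEdgeSAW D' a b),
      0 ≤ (if E ω.verts then xc ^ ω.length else 0) := fun b ω => by
    split_ifs
    · exact pow_nonneg xc_pos.le _
    · exact le_rfl
  unfold TR
  refine (Finset.sum_le_sum fun t _ => ?_).trans (Finset.sum_le_sum_of_subset_of_nonneg
    (Finset.filter_subset_filter _ hDD') fun t _ _ => Finset.sum_nonneg fun ω _ => hnn _ ω)
  have hinj : Function.Injective (inclW hDD' : HexMidEdgeSAW D a s(v, t) → _) :=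
    fun ω ω' h => HexMidEdgeSAW.ext (by have h' := congrArg HexMidEdgeSAW.verts h; exact h')
  calc (∑ ω : HexMidEdgeSAW D a s(v, t), if E ω.verts then xc ^ ω.length else (0 : ℝ))
      = ∑ ω ∈ (Finset.univ : Finset (HexMidEdgeSAW D a s(v, t))).image (inclW hDD'),
          if E ω.verts then xc ^ ω.length else (0 : ℝ) := by
        rw [Finset.sum_image fun x _ y _ h => hinj h]; rfl
    _ ≤ _ := Finset.sum_le_sum_of_subset_of_nonneg (Finset.subset_univ _) fun ω _ _ => hnn _ ω

/-- **The crude constant**: `CrudeBound B₀` forces `B₀ ≥ 1/(2√3)`, by the one-vertex domain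
`{t₀}` with root `s(u₀, t₀)` and star vertex read from `v₀` (`u₀, v₀` two neighbours of `t₀`):
its only walk is `[t₀]`, of defect modulus `x_c/(2√3)` and mass `x_c`. [folklore] -/
theorem crude_constant_le {B₀ : ℝ} (hB : CrudeBound B₀) : 1 / 2 * (Real.sqrt 3)⁻¹ ≤ B₀ := by
  -- the configuration
  let t₀ : HexVertex := (![0, 0], 0)
  let u₀ : HexVertex := (![0, 0], 1)
  let v₀ : HexVertex := (![0, -1], 1)
  have hut : hexGraph.Adj u₀ t₀ := (hexGraph_adj_up 0 0).symm
  have hvt : hexGraph.Adj v₀ t₀ := by have h := hexGraph_adj_dn 0 0; simpa using h.symm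
  have huv : u₀ ≠ v₀ := by decide
  have hut' : u₀ ≠ t₀ := by decide
  have hab : s(u₀, t₀) ≠ s(v₀, t₀) := by
    rw [Ne, Sym2.eq_iff]; rintro (⟨h, -⟩ | ⟨h, -⟩) <;> [exact huv h; exact hut' h]
  -- the unique walk `[t₀]` of `{t₀}` from `s(u₀,t₀)` to `s(v₀,t₀)`
  let w₀ : HexMidEdgeSAW {t₀} s(u₀, t₀) s(v₀, t₀) :=
    { verts := [t₀]
      subset := by simp
      nodup := List.nodup_singleton _
      isChain := List.IsChain.singleton _
      head_mem := by simp
      getLast_mem := by simp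
      eq_of_nil := fun h => by simp at h
      edges_nodup := fun _ => by simpa using hab
      fst_mem := ⟨(SimpleGraph.mem_edgeSet _).2 hut, t₀, Sym2.mem_mk_right _ _, by simp⟩ }
  have huniq : ∀ ω : HexMidEdgeSAW {t₀} s(u₀, t₀) s(v₀, t₀), ω = w₀ := by
    intro ω
    refine HexMidEdgeSAW.ext ?_
    have hsub : ∀ x ∈ ω.verts, x = t₀ := fun x hx => Finset.mem_singleton.1 (ω.subset x hx)
    have hnd := ω.nodup
    rcases hω : ω.verts with _ | ⟨x, _ | ⟨x', rest⟩⟩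
    · exact absurd (ω.eq_of_nil hω) hab
    · rw [hsub x (by rw [hω]; simp)]
    · rw [hω] at hnd hsub
      have hx := hsub x (by simp)
      have hx' := hsub x' (by simp)
      subst hx hx'
      simp at hnd
  have huniv : ∀ σ : ℝ, hexParafermionicObservable {t₀} s(u₀, t₀) xc σ s(v₀, t₀) =
      w₀.weight xc σ := fun σ => by
    rw [hexParafermionicObservable, show (Finset.univ : Finset (HexMidEdgeSAW {t₀} s(u₀, t₀)
      s(v₀, t₀))) = {w₀} from Finset.eq_singleton_iff_unique_mem.2 ⟨Finset.mem_univ _,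
        fun ω _ => huniq ω⟩, Finset.sum_singleton]
  have hstar : star {t₀} v₀ = {t₀} := by
    rw [star, Finset.filter_singleton, if_pos hvt]
  have h := hB {t₀} u₀ t₀ v₀
  rw [defect, mass, hstar, Finset.sum_singleton, Finset.sum_singleton, huniv, huniv, norm_mul,
    Complex.norm_conj, norm_mid_sub hvt, w₀.norm_weight xc_pos.le, w₀.norm_weight xc_pos.le] at h
  have hlen : w₀.length = 1 := rfl
  rw [hlen, pow_one] at h
  exact le_of_mul_le_mul_right h xc_pos

end Crude

/-! ### Splitting and restricting the star sums -/

section Telescoping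

variable {D : Finset HexVertex} {a : Sym2 HexVertex} {v : HexVertex}

/-- `TC` splits over complementary restrictions. [folklore] -/
theorem TC_split (E F : List HexVertex → Prop) :
    TC D a v E = TC D a v (fun l => E l ∧ F l) + TC D a v (fun l => E l ∧ ¬ F l) := by
  simp only [TC, ← Finset.sum_add_distrib, ← mul_add]
  refine Finset.sum_congr rfl fun t _ => ?_
  congr 1
  refine Finset.sum_congr rfl fun ω _ => ?_
  by_cases hE : E ω.verts <;> by_cases hF : F ω.verts <;> simp [hE, hF]

/-- `TC` only evaluates the restriction on vertex lists inside the domain. [folklore] -/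
theorem TC_congr {E E' : List HexVertex → Prop} (h : ∀ l, (∀ q ∈ l, q ∈ D) → (E l ↔ E' l)) :
    TC D a v E = TC D a v E' := by
  refine Finset.sum_congr rfl fun t _ => ?_
  congr 1
  refine Finset.sum_congr rfl fun ω _ => ?_
  rw [show E ω.verts = E' ω.verts from propext (h _ ω.subset)]

/-- A walk of a domain whose vertices lie in a subdomain containing an endpoint of its root is
a walk of the subdomain. [folklore] -/
def restrictW {D₁ : Finset HexVertex} {b : Sym2 HexVertex} (ω : HexMidEdgeSAW D a b)
    (h : ∀ q ∈ ω.verts, q ∈ D₁) (ha : a ∈ hexDomainMidEdges D₁) : HexMidEdgeSAW D₁ a b where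
  verts := ω.verts
  subset := h
  nodup := ω.nodup
  isChain := ω.isChain
  head_mem := ω.head_mem
  getLast_mem := ω.getLast_mem
  eq_of_nil := ω.eq_of_nil
  edges_nodup := ω.edges_nodup
  fst_mem := ha

/-- **Restriction to a subdomain with the same star**: the `TC` of `D₀` restricted to the walks
staying inside `D₁ ⊆ D₀` is the `TC` of `D₁`. [folklore] -/
theorem TC_stay {D₀ D₁ : Finset HexVertex} (hsub : D₁ ⊆ D₀) (hstar : star D₁ v = star D₀ v)
    (ha : a ∈ hexDomainMidEdges D₁) (E : List HexVertex → Prop) :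
    TC D₀ a v (fun l => E l ∧ ∀ q ∈ l, q ∈ D₁) = TC D₁ a v E := by
  rw [TC, TC, hstar]
  refine Finset.sum_congr rfl fun t _ => ?_
  congr 1
  have hinj : Function.Injective (inclW hsub : HexMidEdgeSAW D₁ a s(v, t) → _) :=
    fun ω ω' h => HexMidEdgeSAW.ext (by have h' := congrArg HexMidEdgeSAW.verts h; exact h')
  have hfil : (Finset.univ.filter fun ω : HexMidEdgeSAW D₀ a s(v, t) => ∀ q ∈ ω.verts, q ∈ D₁) =
      (Finset.univ : Finset (HexMidEdgeSAW D₁ a s(v, t))).image (inclW hsub) := by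
    ext ω
    simp only [Finset.mem_filter, Finset.mem_univ, true_and, Finset.mem_image]
    constructor
    · exact fun h => ⟨restrictW ω h ha, HexMidEdgeSAW.ext rfl⟩
    · rintro ⟨ω₁, rfl⟩; exact ω₁.subset
  trans ∑ ω ∈ Finset.univ.filter (fun ω : HexMidEdgeSAW D₀ a s(v, t) => ∀ q ∈ ω.verts, q ∈ D₁),
      if E ω.verts then ω.weight xc (5 / 8) else 0
  · rw [Finset.sum_filter]
    refine Finset.sum_congr rfl fun ω _ => ?_
    by_cases h2 : (∀ q ∈ ω.verts, q ∈ D₁)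
    · rw [if_pos h2]
      by_cases h1 : E ω.verts
      · rw [if_pos ⟨h1, h2⟩, if_pos h1]
      · rw [if_neg (fun h => h1 h.1), if_neg h1]
    · rw [if_neg h2, if_neg (fun h => h2 h.2)]
  · rw [hfil, Finset.sum_image fun x _ y _ h => hinj h]; rfl

end Telescoping

/-- **Registered helper `tm_crude_constant_le`**. [folklore] -/
theorem tm_crude_constant_le : ∀ B₀ : ℝ, CrudeBound B₀ → 1 / 2 * (Real.sqrt 3)⁻¹ ≤ B₀ :=
  fun _ hB => crude_constant_le hB

end Summit.CriticalPhenomena.SAWScalingLimit.Theorems.DefectDecoherence.TipMartingale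

end
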